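import Literature.NumberTheory.Automorphic.SmoothIndTransport
import Literature.NumberTheory.Automorphic.UnitaryGroupPrincipalSeriesH
import Literature.NumberTheory.Automorphic.IrreducibleClassesComapInner
import Literature.NumberTheory.Automorphic.IrreducibleClassesConstituents
import Literature.NumberTheory.Automorphic.AdelicUnitaryGroupDatum
import Mathlib.RepresentationTheory.Intertwining
import HarnessLib

/-!
# R90 · S3 · FILE G kit — transport of the principal series of `U(Φ_N)(L⁺_v)` and of `H_v` along a ground-field change

R90-TF SLAB, section S3 (Rogawski Ch. 13.2 «Endo-H»), dealer R90-C12-plan (g2) «BUNDLE 1» = sockets G3a ∕ G3b ∕ G3c ∕ G4 of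
`Cruxes/H413/Lines/R90_S3_LocalTransportWaveG.lean` (tree sha16 7af8ed512a325101); seat K2E3-p36 (g3); crux H413 = `stmt-HodgeConjecture-24833`,
route `HCCMUnconditional`, lane `--supports … --as helper` (count-neutral).  THIS FILE = the shared KIT behind the bricks
`R90S3TransportHLabels` (G3a, G3b), `R90S3TransportRhoPacket` (G3c), `R90S3TransportRogPacketH` (G4).  SETTING (G §1): a ground-field change is
`Φ : L ⊗ L⁺_v ≃+* L′ ⊗ L′⁺_{v′}` with `e : U(Φ_N)(L⁺_v) ≃ₜ* U(Φ_N)(L′⁺_{v′})` EQUAL TO `GL_N(Φ)` on matrices (`he`; ★ `exists_cmDatum_local_equiv`).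
* §0 GENERIC PACKAGING: equivariant linear iso ⇒ `ρ′ ≅ ρ ∘ φ` (`nonempty_equiv_comp_of_equivariant`), applied form (`equiv_comp_apply`), the box
  `(ρ′ ∘ p₁′) ⊗ (χ₁′ ∘ p₂′) ≅ ((ρ ∘ p₁) ⊗ (χ₁ ∘ p₂)) ∘ Θ` (`nonempty_equiv_twist_comp`), irreducibility (`isIrreducible_of_equiv_comp`).  Generic ON
  PURPOSE: the two carrier spellings of the tree — `(cmDatum L N Φ_N).Local v` (G, ★ `cmPrincipalSeriesH`) and `↥(unitaryGroupOfForm (c ⊗ 1)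
  (cmLocalForm L N v))` (★ `cmPrincipalSeries`), equal by ★ `cmDatum_Local_eq` (`rfl`) — are costly to unify inside applied terms, so every CM
  statement is closed `have key := <generic>; exact key` on folded constants.
* §1 `e` CARRIES `B`, `T`, `N` (`he` is entrywise; `Matrix.BlockTriangular.map`, `glDiagonal d ↦ glDiagonal (Φ ∘ d)`), `e⁻¹ = GL_N(Φ⁻¹)`.
* §2 **`i(χ) ≅ i(χ′) ∘ e` for `χ′(e t) = χ(t)`** (`nonempty_equiv_cmPrincipalSeries_comp_transport`; ★ `SmoothInd.transportEquiv`, two-group twin of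
  ★ `R90S3PrincipalSeriesSimilTransport.nonempty_equiv_cmPrincipalSeries_comp`, template ★ `ParabolicIndGLFieldTransport`): `e(B) = B′`, and on
  `b = t n` the inducing characters agree (`proj′(e b) = e t`, ★ `proj_apply_of_mem_M ∕ _N`; `δ_{B′}^{1/2} ∘ e = δ_B^{1/2}`, ★ `rootDeltaChar_transport`);
  hence `c ∘ e⁻¹ ∈ JH(i(χ′)) ↔ c ∈ JH(i(χ))` (`comap_symm_isConstituentOf_cmPrincipalSeries_iff`).
* §3 the `H_v = U(Φ₂) × U(Φ₁)` twin along `e_H = e₂ × e₁` (G's binders `e₂ he₂ e₁ eH heH`): `i_H(χ₂ ⊠ χ₁) ≅ i_H(χ₂′ ⊠ χ₁′) ∘ e_H`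
  (`nonempty_equiv_cmPrincipalSeriesH_comp_transport`; ★ `cmPrincipalSeriesH = (i(χ₂) ∘ fst) ⊗ (χ₁ ∘ snd)` definitionally), constituents
  (`comap_symm_isConstituentOf_cmPrincipalSeriesH_iff`) and irreducibility (`isIrreducible_cmPrincipalSeriesH_transport`).
★-ONLY IMPORTS; theorems only (no `def`, no instance, no notation, no `sorry`); `maxHeartbeats` 800 k ∕ 4 M on the three re-folding steps (measured).

HONEST LABEL: HC_CM is proved only modulo the 7 printed citations (2 remaining named inputs: hLiu418 = stmt-HodgeConjecture-24832,
h413 = stmt-HodgeConjecture-24833) until rung 0 closes; pure transport of structure over ★ currency; pays no socket by itself (G3a–G4 are paid by the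
brick files, then by G ED. 2).  REL ≠ ★ ≠ BUILT.

## References
* [BernsteinZelevinsky1977] I. N. Bernstein, A. V. Zelevinsky, Ann. Sci. ÉNS 10 (1977), §1.8, §2.3 · [BernsteinZelevinsky1976] iid., Russian Math. Surveys 31:3 (1976), §2.21–2.25.
* [Rogawski1990] J. D. Rogawski, *Automorphic Representations of Unitary Groups in Three Variables*, Ann. of Math. Stud. 123 (1990), §1.10 p. 9, §12.1 pp. 171–172, §12.2 p. 173,
  §14.2 p. 232 · [BushnellHenniart2006] C. J. Bushnell, G. Henniart, *The Local Langlands Conjecture for GL(2)* (2006), §1.1, §9.1.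
-/

set_option autoImplicit false
-- the mandated namespace repeats the single-problem summit's segment (`HodgeConjecture.HodgeConjecture`)
set_option linter.dupNamespace false

noncomputable section

open NumberField IsDedekindDomain
open scoped Matrix MatrixGroups
open Literature.NumberTheory.Automorphic Literature.NumberTheory.Automorphic.UnitaryGroup

namespace Summit.HodgeConjecture.HodgeConjecture.R90.S3

section Generic
variable {k G G' V V' : Type*} [CommRing k] [Group G] [Group G'] [AddCommGroup V] [Module k V] [AddCommGroup V'] [Module k V']

/-- **An equivariant linear isomorphism along a group homomorphism is an isomorphism of representations `ρ′ ≅ ρ ∘ φ`.**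
(Packaging of Mathlib's `Representation.Equiv.mk`; stated generically so that the heavy induced-representation types of §2 are
never unfolded inside an applied goal.) [cite: BernsteinZelevinsky1976, §2.21] -/
theorem nonempty_equiv_comp_of_equivariant (φ : G' →* G) (ρ : Representation k G V) (ρ' : Representation k G' V')
    (Ψ : V' ≃ₗ[k] V) (hΨ : ∀ g' v, Ψ (ρ' g' v) = ρ (φ g') (Ψ v)) :
    Nonempty (ρ'.Equiv (ρ.comp φ)) :=
  ⟨Representation.Equiv.mk Ψ fun g' => LinearMap.ext fun v => hΨ g' v⟩

/-- The applied equivariance of an isomorphism `E : ρ′ ≅ ρ ∘ φ`: `E (ρ′(g′) v) = ρ(φ g′) (E v)` (Mathlib `IntertwiningMap.isIntertwining`).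
[cite: BernsteinZelevinsky1976, §2.21] -/
theorem equiv_comp_apply (φ : G' →* G) {ρ : Representation k G V} {ρ' : Representation k G' V'} (E : ρ'.Equiv (ρ.comp φ))
    (g' : G') (v : V') : E.toLinearEquiv (ρ' g' v) = ρ (φ g') (E.toLinearEquiv v) :=
  LinearMap.congr_fun (E.isIntertwining' g') v

/-- **`(ρ′ ⊠ χ₁′) ≅ (ρ ⊠ χ₁) ∘ Θ` from `ρ′ ≅ ρ ∘ φ`** — transport of the external product with a character.  Here `ρ ⊠ χ₁` is
`(ρ ∘ p₁) ⊗ (χ₁ ∘ p₂)` for a pair of homomorphisms `p₁ : P →* G`, `p₂ : P →* G₁` out of a group `P` (the projections of a product,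
★ `cmPrincipalSeriesH = (i(χ₂) ∘ fst) ⊗ (χ₁ ∘ snd)`; kept abstract so that the instantiation is syntactically the library's term), `Θ : P′ →* P`
is compatible with `φ` on the first leg (`h₁`) and with the characters on the second (`h₂`).  The same linear isomorphism intertwines.
[cite: BushnellHenniart2006, §9.1] [cite: Rogawski1990, §12.1 p. 171] -/
theorem nonempty_equiv_twist_comp {G₁ G₁' P P' : Type*} [Group G₁] [Group G₁'] [Group P] [Group P'] (φ : G' →* G) (Θ : P' →* P)
    (p₁ : P →* G) (p₂ : P →* G₁) (p₁' : P' →* G') (p₂' : P' →* G₁') (χ₁ : G₁ →* kˣ) (χ₁' : G₁' →* kˣ)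
    (h₁ : ∀ x, p₁ (Θ x) = φ (p₁' x)) (h₂ : ∀ x, χ₁ (p₂ (Θ x)) = χ₁' (p₂' x))
    {ρ : Representation k G V} {ρ' : Representation k G' V'} (E : ρ'.Equiv (ρ.comp φ)) :
    Nonempty ((Representation.twist (ρ'.comp p₁') (χ₁'.comp p₂')).Equiv ((Representation.twist (ρ.comp p₁) (χ₁.comp p₂)).comp Θ)) := by
  refine nonempty_equiv_comp_of_equivariant Θ _ _ E.toLinearEquiv fun x v => ?_
  change E.toLinearEquiv (((χ₁' (p₂' x) : kˣ) : k) • ρ' (p₁' x) v) = ((χ₁ (p₂ (Θ x)) : kˣ) : k) • ρ (p₁ (Θ x)) (E.toLinearEquiv v)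
  rw [map_smul, equiv_comp_apply φ E (p₁' x) v, h₁ x, h₂ x]

end Generic

section GenericField
variable {k G G' V V' : Type*} [Field k] [Group G] [Group G'] [AddCommGroup V] [Module k V] [AddCommGroup V'] [Module k V']

/-- **Irreducibility transfers along `ρ′ ≅ ρ ∘ φ`** for an isomorphism `φ` of groups (given as a homomorphism `φ′` agreeing with `φ`
pointwise): `ρ′` irreducible ⇒ `ρ` irreducible (★ `Representation.isIrreducible_of_equivariant_equiv`). [cite: BushnellHenniart2006, §1.1] -/
theorem isIrreducible_of_equiv_comp (φ : G' ≃* G) (φ' : G' →* G) (hφ : ∀ g, φ' g = φ g) {ρ : Representation k G V}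
    {ρ' : Representation k G' V'} (E : ρ'.Equiv (ρ.comp φ')) (h : ρ'.IsIrreducible) : ρ.IsIrreducible := by
  haveI := h
  exact Representation.isIrreducible_of_equivariant_equiv φ E.toLinearEquiv fun g' v => by
    rw [← hφ]; exact equiv_comp_apply φ' E g' v

end GenericField

section CM
variable (L : Type) [Field L] [NumberField L] [IsCMField L] (v : HeightOneSpectrum (𝓞 ↥(maximalRealSubfield L)))
  (L' : Type) [Field L'] [NumberField L'] [IsCMField L'] (v' : HeightOneSpectrum (𝓞 ↥(maximalRealSubfield L')))
  {N : ℕ} (Φ : LocalRing L v ≃+* LocalRing L' v')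
  (e : ↥(unitaryGroupOfForm (conjLocal L (IsCMField.complexConj L) v) (cmLocalForm L N v)) ≃ₜ* ↥(unitaryGroupOfForm (conjLocal L' (IsCMField.complexConj L') v') (cmLocalForm L' N v')))
  (he : ∀ g, ((e g : ↥(unitaryGroupOfForm (conjLocal L' (IsCMField.complexConj L') v') (cmLocalForm L' N v'))) : GL (Fin N) (LocalRing L' v')) =
    Matrix.GeneralLinearGroup.map (Φ : LocalRing L v →+* LocalRing L' v') ((g : ↥(unitaryGroupOfForm (conjLocal L (IsCMField.complexConj L) v) (cmLocalForm L N v))) : GL (Fin N) (LocalRing L v)))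

/-! ## §1 `e = GL_N(Φ)` carries `B`, `T`, `N`; the matrix formula for `e⁻¹` -/

include he in
/-- The entries of `e g` are `Φ` of the entries of `g`. [cite: Rogawski1990, §14.2 p. 232] -/
theorem transport_apply_apply (g : ↥(unitaryGroupOfForm (conjLocal L (IsCMField.complexConj L) v) (cmLocalForm L N v)))
    (i j : Fin N) :
    (((e g : ↥(unitaryGroupOfForm (conjLocal L' (IsCMField.complexConj L') v') (cmLocalForm L' N v'))) : GL (Fin N) (LocalRing L' v')) : Matrix (Fin N) (Fin N) (LocalRing L' v')) i j =
      Φ ((((g : ↥(unitaryGroupOfForm (conjLocal L (IsCMField.complexConj L) v) (cmLocalForm L N v))) : GL (Fin N) (LocalRing L v)) : Matrix (Fin N) (Fin N) (LocalRing L v)) i j) := by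
  rw [he]
  exact Matrix.GeneralLinearGroup.map_apply _ i j _

include he in
/-- The underlying matrix of `e g` is `(g).map Φ`. [cite: Rogawski1990, §14.2 p. 232] -/
theorem coe_transport_apply (g : ↥(unitaryGroupOfForm (conjLocal L (IsCMField.complexConj L) v) (cmLocalForm L N v))) :
    ((e g : ↥(unitaryGroupOfForm (conjLocal L' (IsCMField.complexConj L') v') (cmLocalForm L' N v'))) : GL (Fin N) (LocalRing L' v')).val =
      (((g : ↥(unitaryGroupOfForm (conjLocal L (IsCMField.complexConj L) v) (cmLocalForm L N v))) : GL (Fin N) (LocalRing L v)) : Matrix (Fin N) (Fin N) (LocalRing L v)).map Φ :=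
  Matrix.ext fun i j => transport_apply_apply L v L' v' Φ e he g i j

include he in
/-- **`e⁻¹ = GL_N(Φ⁻¹)` on matrices.** [cite: Rogawski1990, §14.2 p. 232] -/
theorem transport_symm_val (g' : ↥(unitaryGroupOfForm (conjLocal L' (IsCMField.complexConj L') v') (cmLocalForm L' N v'))) :
    ((e.symm g' : ↥(unitaryGroupOfForm (conjLocal L (IsCMField.complexConj L) v) (cmLocalForm L N v))) : GL (Fin N) (LocalRing L v)) =
      Matrix.GeneralLinearGroup.map (Φ.symm : LocalRing L' v' →+* LocalRing L v) ((g' : ↥(unitaryGroupOfForm (conjLocal L' (IsCMField.complexConj L') v') (cmLocalForm L' N v'))) : GL (Fin N) (LocalRing L' v')) := by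
  have h := coe_transport_apply L v L' v' Φ e he (e.symm g')
  rw [ContinuousMulEquiv.apply_symm_apply] at h
  refine Units.ext (Matrix.ext fun i j => ?_)
  rw [Matrix.GeneralLinearGroup.map_apply]
  change _ = Φ.symm ((((g' : ↥(unitaryGroupOfForm (conjLocal L' (IsCMField.complexConj L') v') (cmLocalForm L' N v'))) : GL (Fin N) (LocalRing L' v')) : Matrix (Fin N) (Fin N) (LocalRing L' v')) i j)
  rw [h, Matrix.map_apply, RingEquiv.symm_apply_apply]

include he in
/-- **`e` carries the Borel `B` (upper triangular) onto `B′`.** [cite: Rogawski1990, §1.10 p. 9] -/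
theorem transport_mem_borelU_iff (g : ↥(unitaryGroupOfForm (conjLocal L (IsCMField.complexConj L) v) (cmLocalForm L N v))) :
    e g ∈ borelU (conjLocal L' (IsCMField.complexConj L') v') (cmLocalForm L' N v') ↔
      g ∈ borelU (conjLocal L (IsCMField.complexConj L) v) (cmLocalForm L N v) := by
  rw [mem_borelU_iff, mem_borelU_iff]
  change (((e g : ↥(unitaryGroupOfForm (conjLocal L' (IsCMField.complexConj L') v') (cmLocalForm L' N v'))) : GL (Fin N) (LocalRing L' v')) : Matrix (Fin N) (Fin N) (LocalRing L' v')).BlockTriangular id ↔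
    (((g : ↥(unitaryGroupOfForm (conjLocal L (IsCMField.complexConj L) v) (cmLocalForm L N v))) : GL (Fin N) (LocalRing L v)) : Matrix (Fin N) (Fin N) (LocalRing L v)).BlockTriangular id
  rw [coe_transport_apply L v L' v' Φ e he g]
  constructor
  · intro h
    have h' := h.map (Φ.symm : LocalRing L' v' →+* LocalRing L v)
    have : ((((g : ↥(unitaryGroupOfForm (conjLocal L (IsCMField.complexConj L) v) (cmLocalForm L N v))) : GL (Fin N) (LocalRing L v)) : Matrix (Fin N) (Fin N) (LocalRing L v)).map Φ).map
        (Φ.symm : LocalRing L' v' →+* LocalRing L v) = (((g : ↥(unitaryGroupOfForm (conjLocal L (IsCMField.complexConj L) v) (cmLocalForm L N v))) : GL (Fin N) (LocalRing L v)) : Matrix (Fin N) (Fin N) (LocalRing L v)) :=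
      Matrix.ext fun i j => Φ.symm_apply_apply _
    rwa [this] at h'
  · exact fun h => h.map (Φ : LocalRing L v →+* LocalRing L' v')

include he in
/-- **`e` carries the diagonal torus `T` into `T′`** (`glDiagonal d ↦ glDiagonal (Φ ∘ d)`). [cite: Rogawski1990, §1.10 p. 9] -/
theorem transport_mem_torusU (g : ↥(unitaryGroupOfForm (conjLocal L (IsCMField.complexConj L) v) (cmLocalForm L N v)))
    (hg : g ∈ torusU (conjLocal L (IsCMField.complexConj L) v) (cmLocalForm L N v)) :
    e g ∈ torusU (conjLocal L' (IsCMField.complexConj L') v') (cmLocalForm L' N v') := by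
  obtain ⟨d, hd⟩ := (mem_torusU_iff _).1 hg
  refine (mem_torusU_iff _).2 ⟨fun k => Units.map (Φ : LocalRing L v →+* LocalRing L' v').toMonoidHom (d k), ?_⟩
  refine Units.ext (Matrix.ext fun i j => ?_)
  rw [transport_apply_apply L v L' v' Φ e he g i j, coe_glDiagonal]
  have hd' : ((g : ↥(unitaryGroupOfForm (conjLocal L (IsCMField.complexConj L) v) (cmLocalForm L N v))) : GL (Fin N) (LocalRing L v)).val = Matrix.diagonal fun k => (d k : LocalRing L v) := by
    rw [← coe_glDiagonal N (LocalRing L v) d, hd]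
  rw [hd']
  by_cases hij : i = j
  · subst hij
    rw [Matrix.diagonal_apply_eq, Matrix.diagonal_apply_eq]
    rfl
  · rw [Matrix.diagonal_apply_ne _ hij, Matrix.diagonal_apply_ne _ hij, map_zero]

include he in
/-- … and `T′` ONTO `T` under `e⁻¹` (the same statement at the reversed datum `(Φ⁻¹, e⁻¹)`). [cite: Rogawski1990, §1.10 p. 9] -/
theorem transport_mem_torusU_iff (g : ↥(unitaryGroupOfForm (conjLocal L (IsCMField.complexConj L) v) (cmLocalForm L N v))) :
    e g ∈ torusU (conjLocal L' (IsCMField.complexConj L') v') (cmLocalForm L' N v') ↔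
      g ∈ torusU (conjLocal L (IsCMField.complexConj L) v) (cmLocalForm L N v) := by
  refine ⟨fun h => ?_, transport_mem_torusU L v L' v' Φ e he g⟩
  have h2 := transport_mem_torusU L' v' L v Φ.symm e.symm (transport_symm_val L v L' v' Φ e he) (e g) h
  rwa [ContinuousMulEquiv.symm_apply_apply] at h2

include he in
/-- **`e` carries the unipotent radical `N` (unit upper triangular) onto `N′`.** [cite: Rogawski1990, §1.10 p. 9] -/
theorem transport_mem_unipotentU_iff (g : ↥(unitaryGroupOfForm (conjLocal L (IsCMField.complexConj L) v) (cmLocalForm L N v))) :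
    e g ∈ unipotentU (conjLocal L' (IsCMField.complexConj L') v') (cmLocalForm L' N v') ↔
      g ∈ unipotentU (conjLocal L (IsCMField.complexConj L) v) (cmLocalForm L N v) := by
  have hB := transport_mem_borelU_iff L v L' v' Φ e he g
  rw [mem_borelU_iff, mem_borelU_iff] at hB
  rw [mem_unipotentU_iff, mem_unipotentU_iff]
  refine and_congr hB (forall_congr' fun i => ?_)
  change (((e g : ↥(unitaryGroupOfForm (conjLocal L' (IsCMField.complexConj L') v') (cmLocalForm L' N v'))) : GL (Fin N) (LocalRing L' v')) : Matrix (Fin N) (Fin N) (LocalRing L' v')) i i = 1 ↔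
    (((g : ↥(unitaryGroupOfForm (conjLocal L (IsCMField.complexConj L) v) (cmLocalForm L N v))) : GL (Fin N) (LocalRing L v)) : Matrix (Fin N) (Fin N) (LocalRing L v)) i i = 1
  rw [transport_apply_apply L v L' v' Φ e he g i i]
  exact map_eq_one_iff Φ Φ.injective

/-! ## §2 Transport of the principal series `i(χ)` of `U(Φ_N)(L⁺_v)` along `e` -/

set_option maxHeartbeats 800000 in
include he in
/-- **TRANSPORT OF THE PRINCIPAL SERIES along a ground-field change.**  For `e = GL_N(Φ) : U(Φ_N)(L⁺_v) ≃ₜ* U(Φ_N)(L′⁺_{v′})` and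
characters `χ` of `T`, `χ′` of `T′` with `χ′(e t) = χ(t)` on `T`, pull-back along `e⁻¹` is an isomorphism of representations
`i(χ) ≅ i(χ′) ∘ e` (`f ↦ f ∘ e⁻¹`; ★ `SmoothInd.transportEquiv`): `e(B) = B′` (§1), and on `b = t n ∈ B = TN` the inducing characters
agree — `proj′(e b) = e t` since `e n ∈ N′` (★ `proj_apply_of_mem_M ∕ _N`), `χ′(e t) = χ(t)`, `δ_{B′}^{1/2}(e b) = δ_B^{1/2}(b)`
(★ `rootDeltaChar_transport`).  «`i_{G,M}` commutes with isomorphisms of the data.» [cite: BernsteinZelevinsky1977, §2.3]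
[cite: Rogawski1990, §12.2 p. 173; §14.2 p. 232] -/
theorem nonempty_equiv_cmPrincipalSeries_comp_transport
    (χ : ↥(torusU (conjLocal L (IsCMField.complexConj L) v) (cmLocalForm L N v)) →* ℂˣ)
    (χ' : ↥(torusU (conjLocal L' (IsCMField.complexConj L') v') (cmLocalForm L' N v')) →* ℂˣ)
    (hχ : ∀ (t : ↥(torusU (conjLocal L (IsCMField.complexConj L) v) (cmLocalForm L N v)))
      (ht : e t ∈ torusU (conjLocal L' (IsCMField.complexConj L') v') (cmLocalForm L' N v')), χ' ⟨e t, ht⟩ = χ t) :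
    Nonempty ((cmPrincipalSeries L N v χ).Equiv
      ((cmPrincipalSeries L' N v' χ').comp
        (e : ↥(unitaryGroupOfForm (conjLocal L (IsCMField.complexConj L) v) (cmLocalForm L N v)) →* ↥(unitaryGroupOfForm (conjLocal L' (IsCMField.complexConj L') v') (cmLocalForm L' N v'))))) := by
  haveI := locallyCompactSpace_cmBorelU L N v
  haveI := locallyCompactSpace_cmBorelU L' N v'
  -- `e(B) = B′`
  have hB : ∀ x, e.toMulEquiv x ∈ (cmBorelTriple L' N v').P ↔ x ∈ (cmBorelTriple L N v).P :=
    fun x => transport_mem_borelU_iff L v L' v' Φ e he x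
  -- the inducing characters agree along `e`
  have hσ : ∀ x : ↥(cmBorelTriple L N v).P,
      (Representation.twist
        (((Representation.trivial ℂ ↥(torusU (conjLocal L (IsCMField.complexConj L) v) (cmLocalForm L N v)) ℂ).twist χ).comp
          (cmBorelTriple L N v).proj) (rootDeltaChar (cmBorelTriple L N v).P)) x =
      (Representation.twist
        (((Representation.trivial ℂ ↥(torusU (conjLocal L' (IsCMField.complexConj L') v') (cmLocalForm L' N v')) ℂ).twist χ').comp
          (cmBorelTriple L' N v').proj) (rootDeltaChar (cmBorelTriple L' N v').P)) ⟨e.toMulEquiv x, (hB x).2 x.2⟩ := by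
    intro x
    -- `x = t n`, `t = proj x ∈ T`, `n ∈ N`; `e x = e t · e n` with `e t ∈ T′`, `e n ∈ N′`
    obtain ⟨t, htdef⟩ : ∃ t, (cmBorelTriple L N v).proj x = t := ⟨_, rfl⟩
    have hn : ((t : ↥(unitaryGroupOfForm (conjLocal L (IsCMField.complexConj L) v) (cmLocalForm L N v)))⁻¹ *
        (x : ↥(unitaryGroupOfForm (conjLocal L (IsCMField.complexConj L) v) (cmLocalForm L N v)))) ∈ (cmBorelTriple L N v).N :=
      htdef ▸ (cmBorelTriple L N v).proj_inv_mul_mem x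
    have het : e (t : ↥(unitaryGroupOfForm (conjLocal L (IsCMField.complexConj L) v) (cmLocalForm L N v))) ∈
        torusU (conjLocal L' (IsCMField.complexConj L') v') (cmLocalForm L' N v') :=
      transport_mem_torusU L v L' v' Φ e he _ t.2
    have hen : e (((t : ↥(unitaryGroupOfForm (conjLocal L (IsCMField.complexConj L) v) (cmLocalForm L N v)))⁻¹ *
        (x : ↥(unitaryGroupOfForm (conjLocal L (IsCMField.complexConj L) v) (cmLocalForm L N v))))) ∈
        unipotentU (conjLocal L' (IsCMField.complexConj L') v') (cmLocalForm L' N v') :=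
      (transport_mem_unipotentU_iff L v L' v' Φ e he _).2 hn
    -- the torus part of `e x` is `e t`
    have hproj : ((cmBorelTriple L' N v').proj ⟨e.toMulEquiv x, (hB x).2 x.2⟩ :
        ↥(unitaryGroupOfForm (conjLocal L' (IsCMField.complexConj L') v') (cmLocalForm L' N v'))) =
        e (t : ↥(unitaryGroupOfForm (conjLocal L (IsCMField.complexConj L) v) (cmLocalForm L N v))) := by
      have hsplit : (⟨e.toMulEquiv x, (hB x).2 x.2⟩ : ↥(cmBorelTriple L' N v').P) =
          ⟨e (t : ↥(unitaryGroupOfForm (conjLocal L (IsCMField.complexConj L) v) (cmLocalForm L N v))),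
            torusU_le_borelU _ _ het⟩ *
          ⟨e (((t : ↥(unitaryGroupOfForm (conjLocal L (IsCMField.complexConj L) v) (cmLocalForm L N v)))⁻¹ *
              (x : ↥(unitaryGroupOfForm (conjLocal L (IsCMField.complexConj L) v) (cmLocalForm L N v))))),
            unipotentU_le_borelU _ _ hen⟩ := by
        apply Subtype.ext
        change e (x : ↥(unitaryGroupOfForm (conjLocal L (IsCMField.complexConj L) v) (cmLocalForm L N v))) = e _ * e _
        rw [← map_mul, mul_inv_cancel_left]
      rw [hsplit, map_mul,
        (cmBorelTriple L' N v').proj_apply_of_mem_N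
          ⟨e (((t : ↥(unitaryGroupOfForm (conjLocal L (IsCMField.complexConj L) v) (cmLocalForm L N v))))⁻¹ * (x : ↥(unitaryGroupOfForm (conjLocal L (IsCMField.complexConj L) v) (cmLocalForm L N v)))), unipotentU_le_borelU _ _ hen⟩ hen,
        mul_one]
      exact (cmBorelTriple L' N v').proj_apply_of_mem_M ⟨e (t : ↥(unitaryGroupOfForm (conjLocal L (IsCMField.complexConj L) v) (cmLocalForm L N v))), torusU_le_borelU _ _ het⟩ het
    have hprojT : (cmBorelTriple L' N v').proj ⟨e.toMulEquiv x, (hB x).2 x.2⟩ =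
        ⟨e (t : ↥(unitaryGroupOfForm (conjLocal L (IsCMField.complexConj L) v) (cmLocalForm L N v))), het⟩ :=
      Subtype.ext hproj
    have hχx : χ' ((cmBorelTriple L' N v').proj ⟨e.toMulEquiv x, (hB x).2 x.2⟩) = χ ((cmBorelTriple L N v).proj x) := by
      rw [hprojT, htdef]; exact hχ t het
    apply LinearMap.ext
    intro z
    change ((rootDeltaChar (cmBorelTriple L N v).P x : ℂˣ) : ℂ) * (((χ ((cmBorelTriple L N v).proj x) : ℂˣ) : ℂ) * z) =
      ((rootDeltaChar (cmBorelTriple L' N v').P ⟨e.toMulEquiv x, (hB x).2 x.2⟩ : ℂˣ) : ℂ) *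
        (((χ' ((cmBorelTriple L' N v').proj ⟨e.toMulEquiv x, (hB x).2 x.2⟩) : ℂˣ) : ℂ) * z)
    rw [Representation.rootDeltaChar_transport e.toMulEquiv e.continuous e.symm.continuous hB x, hχx]
  -- ★ transport of smooth induction along `e`, packaged by §0 (kept folded: `have` + `exact`)
  have key := nonempty_equiv_comp_of_equivariant
    (e : ↥(unitaryGroupOfForm (conjLocal L (IsCMField.complexConj L) v) (cmLocalForm L N v)) →* ↥(unitaryGroupOfForm (conjLocal L' (IsCMField.complexConj L') v') (cmLocalForm L' N v')))
    (Representation.smoothIndRep (cmBorelTriple L' N v').P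
      (Representation.twist
        (((Representation.trivial ℂ ↥(torusU (conjLocal L' (IsCMField.complexConj L') v') (cmLocalForm L' N v')) ℂ).twist χ').comp
          (cmBorelTriple L' N v').proj) (rootDeltaChar (cmBorelTriple L' N v').P)))
    (Representation.smoothIndRep (cmBorelTriple L N v).P
      (Representation.twist
        (((Representation.trivial ℂ ↥(torusU (conjLocal L (IsCMField.complexConj L) v) (cmLocalForm L N v)) ℂ).twist χ).comp
          (cmBorelTriple L N v).proj) (rootDeltaChar (cmBorelTriple L N v).P)))
    (Representation.SmoothInd.transportEquiv e.toMulEquiv e.continuous e.symm.continuous hB hσ)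
    fun g f => Representation.SmoothInd.transportEquiv_smoothIndRep e.toMulEquiv e.continuous e.symm.continuous hB hσ g f
  exact key

set_option maxHeartbeats 800000 in
include he in
/-- **`JH(i(χ′)) = e_* JH(i(χ))`**: a class `c` of `U(Φ_N)(L⁺_v)` is a constituent of `i(χ)` iff its transport `c ∘ e⁻¹` (★ `IrrClass.comap
e.symm`) is a constituent of `i(χ′)` (★ `isConstituentOf_congr` + ★ `isConstituentOf_comp_iff_comap_symm`). [cite: Rogawski1990, §12.2 p. 173]
[cite: BernsteinZelevinsky1977, §2.3] -/
theorem comap_symm_isConstituentOf_cmPrincipalSeries_iff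
    (χ : ↥(torusU (conjLocal L (IsCMField.complexConj L) v) (cmLocalForm L N v)) →* ℂˣ)
    (χ' : ↥(torusU (conjLocal L' (IsCMField.complexConj L') v') (cmLocalForm L' N v')) →* ℂˣ)
    (hχ : ∀ (t : ↥(torusU (conjLocal L (IsCMField.complexConj L) v) (cmLocalForm L N v)))
      (ht : e t ∈ torusU (conjLocal L' (IsCMField.complexConj L') v') (cmLocalForm L' N v')), χ' ⟨e t, ht⟩ = χ t)
    (c : IrrClass ↥(unitaryGroupOfForm (conjLocal L (IsCMField.complexConj L) v) (cmLocalForm L N v))) :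
    (IrrClass.comap e.symm c).IsConstituentOf (cmPrincipalSeries L' N v' χ') ↔ c.IsConstituentOf (cmPrincipalSeries L N v χ) := by
  obtain ⟨E⟩ := nonempty_equiv_cmPrincipalSeries_comp_transport L v L' v' Φ e he χ χ' hχ
  rw [IrrClass.isConstituentOf_congr E c]
  exact (IrrClass.isConstituentOf_comp_iff_comap_symm e (cmPrincipalSeries L' N v' χ') c).symm
end CM

/-! ## §3 The `H_v`-level twin along `e_H = e₂ × e₁` — FILE G's binders and carrier spelling `(cmDatum L N Φ_N).Local v` (= §2's by ★ `cmDatum_Local_eq`, `rfl`) -/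

section H
variable (L : Type) [Field L] [NumberField L] [IsCMField L] (v : HeightOneSpectrum (𝓞 ↥(maximalRealSubfield L)))
  (L' : Type) [Field L'] [NumberField L'] [IsCMField L'] (v' : HeightOneSpectrum (𝓞 ↥(maximalRealSubfield L')))
  (Φ : LocalRing L v ≃+* LocalRing L' v')
  (e₂ : (cmDatum L 2 (Matrix.of fun i j : Fin 2 => if i.val + j.val + 1 = 2 then (1 : L) else 0)).Local v ≃ₜ* (cmDatum L' 2 (Matrix.of fun i j : Fin 2 => if i.val + j.val + 1 = 2 then (1 : L') else 0)).Local v')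
  (he₂ : ∀ g, ((e₂ g).val : GL (Fin 2) (LocalRing L' v')) =
    Matrix.GeneralLinearGroup.map (Φ : LocalRing L v →+* LocalRing L' v') (g.val : GL (Fin 2) (LocalRing L v)))
  (e₁ : (cmDatum L 1 (Matrix.of fun i j : Fin 1 => if i.val + j.val + 1 = 1 then (1 : L) else 0)).Local v ≃ₜ* (cmDatum L' 1 (Matrix.of fun i j : Fin 1 => if i.val + j.val + 1 = 1 then (1 : L') else 0)).Local v')
  (eH : ((cmDatum L 2 (Matrix.of fun i j : Fin 2 => if i.val + j.val + 1 = 2 then (1 : L) else 0)).Local v × (cmDatum L 1 (Matrix.of fun i j : Fin 1 => if i.val + j.val + 1 = 1 then (1 : L) else 0)).Local v) ≃ₜ* ((cmDatum L' 2 (Matrix.of fun i j : Fin 2 => if i.val + j.val + 1 = 2 then (1 : L') else 0)).Local v' × (cmDatum L' 1 (Matrix.of fun i j : Fin 1 => if i.val + j.val + 1 = 1 then (1 : L') else 0)).Local v'))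
  (heH : ∀ h, eH h = (e₂ h.1, e₁ h.2))

set_option maxHeartbeats 4000000 in
include he₂ heH in
/-- **TRANSPORT OF `i_H(χ₂ ⊠ χ₁)` along `e_H = e₂ × e₁`**: for `χ₂′(e₂ t) = χ₂(t)` on the torus and `χ₁′(e₁ g) = χ₁(g)` on `U(Φ₁)`,
`i_H(χ₂ ⊠ χ₁) ≅ i_H(χ₂′ ⊠ χ₁′) ∘ e_H` (★ `cmPrincipalSeriesH_apply`: `i_H(χ₂ ⊠ χ₁)(g₂, g₁) = χ₁(g₁) • i(χ₂)(g₂)`; §2 on the `U(Φ₂)` factor).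
[cite: Rogawski1990, §12.1 pp. 171–172] [cite: BernsteinZelevinsky1977, §2.3] -/
theorem nonempty_equiv_cmPrincipalSeriesH_comp_transport
    (χ₂ : ↥(torusU (conjLocal L (IsCMField.complexConj L) v) (cmLocalForm L 2 v)) →* ℂˣ)
    (χ₂' : ↥(torusU (conjLocal L' (IsCMField.complexConj L') v') (cmLocalForm L' 2 v')) →* ℂˣ)
    (hχ₂ : ∀ (t : ↥(torusU (conjLocal L (IsCMField.complexConj L) v) (cmLocalForm L 2 v)))
      (ht : e₂ (t : ↥(unitaryGroupOfForm (conjLocal L (IsCMField.complexConj L) v) (cmLocalForm L 2 v))) ∈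
        torusU (conjLocal L' (IsCMField.complexConj L') v') (cmLocalForm L' 2 v')),
      χ₂' ⟨e₂ (t : ↥(unitaryGroupOfForm (conjLocal L (IsCMField.complexConj L) v) (cmLocalForm L 2 v))), ht⟩ = χ₂ t)
    (χ₁ : (cmDatum L 1 (Matrix.of fun i j : Fin 1 => if i.val + j.val + 1 = 1 then (1 : L) else 0)).Local v →* ℂˣ)
    (χ₁' : (cmDatum L' 1 (Matrix.of fun i j : Fin 1 => if i.val + j.val + 1 = 1 then (1 : L') else 0)).Local v' →* ℂˣ)
    (hχ₁ : ∀ g, χ₁' (e₁ g) = χ₁ g) :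
    Nonempty ((cmPrincipalSeriesH L v χ₂ χ₁).Equiv
      ((cmPrincipalSeriesH L' v' χ₂' χ₁').comp
        (eH : ((cmDatum L 2 (Matrix.of fun i j : Fin 2 => if i.val + j.val + 1 = 2 then (1 : L) else 0)).Local v × (cmDatum L 1 (Matrix.of fun i j : Fin 1 => if i.val + j.val + 1 = 1 then (1 : L) else 0)).Local v) →* ((cmDatum L' 2 (Matrix.of fun i j : Fin 2 => if i.val + j.val + 1 = 2 then (1 : L') else 0)).Local v' × (cmDatum L' 1 (Matrix.of fun i j : Fin 1 => if i.val + j.val + 1 = 1 then (1 : L') else 0)).Local v')))) := by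
  -- §2 on the `U(Φ₂)` factor (`e₂`, `he₂` are accepted by ONE definitional unfolding of the carrier spelling each)
  obtain ⟨E⟩ := nonempty_equiv_cmPrincipalSeries_comp_transport L v L' v' Φ e₂ he₂ χ₂ χ₂' hχ₂
  -- the box with `χ₁` (§0 `nonempty_equiv_twist_comp`, the projections passed exactly as ★ `cmPrincipalSeriesH` spells them), re-folded to
  -- `cmPrincipalSeriesH` by `have` + `exact` (definitional unfolding of the def, syntactic below it)
  have key := nonempty_equiv_twist_comp _
    (eH : ((cmDatum L 2 (Matrix.of fun i j : Fin 2 => if i.val + j.val + 1 = 2 then (1 : L) else 0)).Local v × (cmDatum L 1 (Matrix.of fun i j : Fin 1 => if i.val + j.val + 1 = 1 then (1 : L) else 0)).Local v) →* ((cmDatum L' 2 (Matrix.of fun i j : Fin 2 => if i.val + j.val + 1 = 2 then (1 : L') else 0)).Local v' × (cmDatum L' 1 (Matrix.of fun i j : Fin 1 => if i.val + j.val + 1 = 1 then (1 : L') else 0)).Local v'))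
    (MonoidHom.fst ((cmDatum L' 2 (Matrix.of fun i j : Fin 2 => if i.val + j.val + 1 = 2 then (1 : L') else 0)).Local v')
      ((cmDatum L' 1 (Matrix.of fun i j : Fin 1 => if i.val + j.val + 1 = 1 then (1 : L') else 0)).Local v'))
    (MonoidHom.snd ((cmDatum L' 2 (Matrix.of fun i j : Fin 2 => if i.val + j.val + 1 = 2 then (1 : L') else 0)).Local v')
      ((cmDatum L' 1 (Matrix.of fun i j : Fin 1 => if i.val + j.val + 1 = 1 then (1 : L') else 0)).Local v'))
    (MonoidHom.fst ((cmDatum L 2 (Matrix.of fun i j : Fin 2 => if i.val + j.val + 1 = 2 then (1 : L) else 0)).Local v)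
      ((cmDatum L 1 (Matrix.of fun i j : Fin 1 => if i.val + j.val + 1 = 1 then (1 : L) else 0)).Local v))
    (MonoidHom.snd ((cmDatum L 2 (Matrix.of fun i j : Fin 2 => if i.val + j.val + 1 = 2 then (1 : L) else 0)).Local v)
      ((cmDatum L 1 (Matrix.of fun i j : Fin 1 => if i.val + j.val + 1 = 1 then (1 : L) else 0)).Local v))
    χ₁' χ₁
    (fun x => by rw [MonoidHom.coe_coe, MonoidHom.coe_fst, MonoidHom.coe_fst, heH x]; rfl)
    (fun x => by rw [MonoidHom.coe_coe, MonoidHom.coe_snd, MonoidHom.coe_snd, heH x]; exact hχ₁ x.2) E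
  exact key

set_option maxHeartbeats 800000 in
include he₂ heH in
/-- **`JH(i_H(χ₂′ ⊠ χ₁′)) = (e_H)_* JH(i_H(χ₂ ⊠ χ₁))`**: a class of `H_v` is a constituent of `i_H(χ₂ ⊠ χ₁)` iff its transport along `e_H⁻¹`
(★ `IrrClass.comap eH.symm`) is a constituent of `i_H(χ₂′ ⊠ χ₁′)`. [cite: Rogawski1990, §12.1 pp. 171–172] -/
theorem comap_symm_isConstituentOf_cmPrincipalSeriesH_iff
    (χ₂ : ↥(torusU (conjLocal L (IsCMField.complexConj L) v) (cmLocalForm L 2 v)) →* ℂˣ)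
    (χ₂' : ↥(torusU (conjLocal L' (IsCMField.complexConj L') v') (cmLocalForm L' 2 v')) →* ℂˣ)
    (hχ₂ : ∀ (t : ↥(torusU (conjLocal L (IsCMField.complexConj L) v) (cmLocalForm L 2 v)))
      (ht : e₂ (t : ↥(unitaryGroupOfForm (conjLocal L (IsCMField.complexConj L) v) (cmLocalForm L 2 v))) ∈
        torusU (conjLocal L' (IsCMField.complexConj L') v') (cmLocalForm L' 2 v')),
      χ₂' ⟨e₂ (t : ↥(unitaryGroupOfForm (conjLocal L (IsCMField.complexConj L) v) (cmLocalForm L 2 v))), ht⟩ = χ₂ t)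
    (χ₁ : (cmDatum L 1 (Matrix.of fun i j : Fin 1 => if i.val + j.val + 1 = 1 then (1 : L) else 0)).Local v →* ℂˣ)
    (χ₁' : (cmDatum L' 1 (Matrix.of fun i j : Fin 1 => if i.val + j.val + 1 = 1 then (1 : L') else 0)).Local v' →* ℂˣ)
    (hχ₁ : ∀ g, χ₁' (e₁ g) = χ₁ g)
    (c : IrrClass ((cmDatum L 2 (Matrix.of fun i j : Fin 2 => if i.val + j.val + 1 = 2 then (1 : L) else 0)).Local v × (cmDatum L 1 (Matrix.of fun i j : Fin 1 => if i.val + j.val + 1 = 1 then (1 : L) else 0)).Local v)) :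
    (IrrClass.comap eH.symm c).IsConstituentOf (cmPrincipalSeriesH L' v' χ₂' χ₁') ↔
      c.IsConstituentOf (cmPrincipalSeriesH L v χ₂ χ₁) := by
  obtain ⟨E⟩ := nonempty_equiv_cmPrincipalSeriesH_comp_transport L v L' v' Φ e₂ he₂ e₁ eH heH χ₂ χ₂' hχ₂ χ₁ χ₁' hχ₁
  rw [IrrClass.isConstituentOf_congr E c]
  exact (IrrClass.isConstituentOf_comp_iff_comap_symm eH (cmPrincipalSeriesH L' v' χ₂' χ₁') c).symm

set_option maxHeartbeats 800000 in
include he₂ heH in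
/-- **Irreducibility of `i_H(χ)` is transported**: `i_H(χ₂ ⊠ χ₁)` irreducible ⇒ `i_H(χ₂′ ⊠ χ₁′)` irreducible (§0 `isIrreducible_of_equiv_comp`).
[cite: Rogawski1990, §12.1 pp. 171–172] [cite: BushnellHenniart2006, §1.1] -/
theorem isIrreducible_cmPrincipalSeriesH_transport
    (χ₂ : ↥(torusU (conjLocal L (IsCMField.complexConj L) v) (cmLocalForm L 2 v)) →* ℂˣ)
    (χ₂' : ↥(torusU (conjLocal L' (IsCMField.complexConj L') v') (cmLocalForm L' 2 v')) →* ℂˣ)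
    (hχ₂ : ∀ (t : ↥(torusU (conjLocal L (IsCMField.complexConj L) v) (cmLocalForm L 2 v)))
      (ht : e₂ (t : ↥(unitaryGroupOfForm (conjLocal L (IsCMField.complexConj L) v) (cmLocalForm L 2 v))) ∈
        torusU (conjLocal L' (IsCMField.complexConj L') v') (cmLocalForm L' 2 v')),
      χ₂' ⟨e₂ (t : ↥(unitaryGroupOfForm (conjLocal L (IsCMField.complexConj L) v) (cmLocalForm L 2 v))), ht⟩ = χ₂ t)
    (χ₁ : (cmDatum L 1 (Matrix.of fun i j : Fin 1 => if i.val + j.val + 1 = 1 then (1 : L) else 0)).Local v →* ℂˣ)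
    (χ₁' : (cmDatum L' 1 (Matrix.of fun i j : Fin 1 => if i.val + j.val + 1 = 1 then (1 : L') else 0)).Local v' →* ℂˣ)
    (hχ₁ : ∀ g, χ₁' (e₁ g) = χ₁ g)
    (hirr : (cmPrincipalSeriesH L v χ₂ χ₁).IsIrreducible) :
    (cmPrincipalSeriesH L' v' χ₂' χ₁').IsIrreducible := by
  obtain ⟨E⟩ := nonempty_equiv_cmPrincipalSeriesH_comp_transport L v L' v' Φ e₂ he₂ e₁ eH heH χ₂ χ₂' hχ₂ χ₁ χ₁' hχ₁
  exact isIrreducible_of_equiv_comp eH.toMulEquiv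
    (eH : ((cmDatum L 2 (Matrix.of fun i j : Fin 2 => if i.val + j.val + 1 = 2 then (1 : L) else 0)).Local v × (cmDatum L 1 (Matrix.of fun i j : Fin 1 => if i.val + j.val + 1 = 1 then (1 : L) else 0)).Local v) →* ((cmDatum L' 2 (Matrix.of fun i j : Fin 2 => if i.val + j.val + 1 = 2 then (1 : L') else 0)).Local v' × (cmDatum L' 1 (Matrix.of fun i j : Fin 1 => if i.val + j.val + 1 = 1 then (1 : L') else 0)).Local v'))
    (fun _ => rfl) E hirr
end H

end Summit.HodgeConjecture.HodgeConjecture.R90.S3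

end
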